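import Summits.QuantumAdvantage.QuantumAdvantage.Theorems.CubicForrelationInPrBPP.Negative.SignedSlice

/-!
# `CubicForrelationInPrBPP` — negative knowledge: given a NORMALITY FLAT the sign of an exact forrelation is one evaluation away

Support file for crux `stmt-QuantumAdvantage-2204` (route `QuantumAdvantage/CubicForrelation`), by the standing
disprover refuter-cdisprove-stmt-QuantumAdvantage-2204-g2-0 (2026-08-15); sequel to `Negative/SignedSlice.lean`.

The crux (cubic 2-fold Forrelation `∈ PromiseBPP'`) is true on paper, and its engine is blind to the SIGNED slice
(`SignedSlice.signed_slice_defeats_table_deciders`), which on the exact slice is the sign of the bias of a cubic bent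
function (`SignedSlice.forrelation_mul_bias_eq`). This file proves the Poisson-summation identity behind the classical
attack on the signed slice for Maiorana–McFarland-type data: if `g` is AFFINE (through `w`) on a flat — the image of an
xor-homomorphism `φ : {0,1}ᵐ → {0,1}ⁿ` — then for an exact pair (`S² = 8ⁿ`)

  `S · ∑_{v ⊥ φ} f(w ⊕ v) = 4ⁿ · g(0)`   (`fsum_mul_cosetBias_eq`; `m = 0` is `fsum_mul_bias_eq`),

and over the tree's `forrelation`: `Φ · ∑_{v ⊥ φ} (-1)^{f(w ⊕ v)} = √(2ⁿ) (-1)^{g(0)}`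
(`forrelation_mul_cosetBias_eq`). For a normality flat (`m = n/2`, `φ` injective) the dual coset has `2^{n/2}` points, so
all its terms agree and `Φ = (-1)^{g(0)} (-1)^{f(w)}`: GIVEN the flat, the signed exact slice costs one evaluation —
so its classical hardness on the MM# orbit is at most that of FINDING an `n/2`-flat of affinity of a cubic bent function
(an IP1S/MinRank-type search), while the quantum Forrelation circuit reads the sign without any flat.
Ingredient: the character sum over a flat, `sum_twist_hom` (`2ᵐ` or `0`).

## References

* [AaronsonAmbainis2018] S. Aaronson, A. Ambainis, Forrelation, SIAM J. Comput. 47 (2018), §1.1.1.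
* [ODonnell2014] R. O'Donnell, Analysis of Boolean Functions (2014), §1.4, §3.3 (Poisson summation over subspaces).
* C. Carlet, Boolean Functions for Cryptography and Coding Theory, CUP 2021, §6.1.14 (normal bent functions) —
  orientation only.
-/

noncomputable section

namespace Summit.QuantumAdvantage.QuantumAdvantage.Theorems.CubicForrelationInPrBPP.Negative

open Finset
open Literature.Computability.QuantumComplexity
open Literature.Computability.QuantumComplexity.BuzetChailloux (bxor zeroVec twist_bxor_right
  sum_twist_left bxor_eq_zeroVec_iff twist_zeroVec_right signOf_sq phi_signOf bxorPerm bxorPerm_apply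
  bxor_comm bxor_bxor_cancel_left)
open Literature.Computability.QuantumComplexity.DerivativeWalsh

/-! ### Flats of affinity and the sign of an exact forrelation

A "flat" is the image of an xor-homomorphism `φ : {0,1}ᵐ → {0,1}ⁿ`; `g` is `w`-AFFINE on it when
`(-1)^{g(φ z)} (-1)^{w·φ z}` is constant. Then the Walsh data of the exact partner `f` on the dual coset
`w ⊕ V^⊥` carries the sign: `S · ∑_{v ∈ V^⊥} f(w ⊕ v) = 4ⁿ g(0)` — for `m = 0` this is `fsum_mul_bias_eq`,
and for `|V^⊥| = 2^{n/2}` (a normality flat of dimension `n/2`) the coset sum is `± 2^{n/2}`, so `f` is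
constant on the coset and ONE evaluation `f(w)` gives `sgn S = g(0) f(w)`: the classical algorithm for the
signed exact slice on Maiorana–McFarland-type instances, GIVEN the flat (SIGNED.md §2). -/

section Flat

variable {m n : ℕ}

/-- Character sums over a flat: `∑_z (-1)^{v·φ(z)}` is `2ᵐ` if `v ⊥ φ` and `0` otherwise. [folklore] -/
theorem sum_twist_hom (φ : (Fin m → Bool) → (Fin n → Bool))
    (hφ : ∀ z z', φ (bxor z z') = bxor (φ z) (φ z')) (v : Fin n → Bool) :
    ∑ z, twist v (φ z) = if (∀ z, twist v (φ z) = 1) then (2 : ℝ) ^ m else 0 := by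
  split_ifs with h
  · rw [sum_congr rfl fun z _ => h z, sum_const, card_univ, Fintype.card_fun, Fintype.card_bool,
      Fintype.card_fin, nsmul_eq_mul, mul_one]
    push_cast; rfl
  · push Not at h
    obtain ⟨z₀, hz₀⟩ := h
    have hneg : twist v (φ z₀) = -1 := (Simon.twist_eq_one_or v (φ z₀)).resolve_left hz₀
    have key : ∑ z, twist v (φ z) = -∑ z, twist v (φ z) := by
      calc ∑ z, twist v (φ z) = ∑ z, twist v (φ (bxor z₀ z)) := by
              rw [← Equiv.sum_comp (bxorPerm z₀) (fun z => twist v (φ z))]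
              rfl
        _ = ∑ z, twist v (φ z₀) * twist v (φ z) :=
              sum_congr rfl fun z _ => by rw [hφ, twist_bxor_right]
        _ = -∑ z, twist v (φ z) := by rw [← mul_sum, hneg]; ring
    linarith

/-- **Sign from a flat of affinity.** For `±1`-valued `f, g` with `S(f,g)² = 8ⁿ` (exact pair) and an
xor-homomorphism `φ` on whose image `g` is `w`-affine (`g(φ z)·(-1)^{w·φ z} = g(0)` for all `z`):
`S · ∑_v [v ⊥ φ] f(w ⊕ v) = 4ⁿ · g(0)`. [folklore] -/
theorem fsum_mul_cosetBias_eq (φ : (Fin m → Bool) → (Fin n → Bool))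
    (hφ : ∀ z z', φ (bxor z z') = bxor (φ z) (φ z')) (f g : (Fin n → Bool) → ℝ)
    (hf : ∀ x, f x ^ 2 = 1) (hg : ∀ y, g y ^ 2 = 1) (hS : fsum f g ^ 2 = (8 : ℝ) ^ n)
    (w : Fin n → Bool) (haff : ∀ z, g (φ z) * twist w (φ z) = g zeroVec) :
    fsum f g * ∑ v, (if (∀ z, twist v (φ z) = 1) then f (bxor w v) else 0) =
      (2 : ℝ) ^ n * 2 ^ n * g zeroVec := by
  have h2n : (2 : ℝ) ^ n ≠ 0 := pow_ne_zero _ two_ne_zero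
  have h2m : (2 : ℝ) ^ m ≠ 0 := pow_ne_zero _ two_ne_zero
  -- (1) the flat sum, directly
  have h1 : ∑ z, g (φ z) * twist w (φ z) = (2 : ℝ) ^ m * g zeroVec := by
    rw [sum_congr rfl fun z _ => haff z, sum_const, card_univ, Fintype.card_fun, Fintype.card_bool,
      Fintype.card_fin, nsmul_eq_mul]
    push_cast; ring
  -- (2) the flat sum, through Fourier inversion and the character sums over the flat
  have hinv : ∀ x, g x = ((2 : ℝ) ^ n)⁻¹ * ∑ u, W g u * twist u x := by
    intro x; rw [sum_W_mul_twist]; field_simp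
  have h2 : ∑ z, g (φ z) * twist w (φ z) =
      ((2 : ℝ) ^ n)⁻¹ * ∑ u, W g u * (if (∀ z, twist (bxor u w) (φ z) = 1) then (2 : ℝ) ^ m else 0) := by
    have e1 : ∀ z : Fin m → Bool, g (φ z) * twist w (φ z) =
        ((2 : ℝ) ^ n)⁻¹ * ∑ u, W g u * twist (bxor u w) (φ z) := by
      intro z
      rw [hinv (φ z), mul_assoc, sum_mul]
      congr 1
      refine sum_congr rfl fun u _ => ?_
      rw [show bxor u w = fun i => u i ^^ w i from rfl, Simon.twist_xor_left]
      ring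
    rw [sum_congr rfl fun z _ => e1 z, ← mul_sum, sum_comm]
    congr 1
    refine sum_congr rfl fun u _ => ?_
    rw [← mul_sum, sum_twist_hom φ hφ]
  -- (3) reindex `u = w ⊕ v` and insert rigidity `W_g = (S/2ⁿ) f`
  have h3 : ∑ u, W g u * (if (∀ z, twist (bxor u w) (φ z) = 1) then (2 : ℝ) ^ m else 0) =
      (2 : ℝ) ^ m * (fsum f g / 2 ^ n) *
        ∑ v, (if (∀ z, twist v (φ z) = 1) then f (bxor w v) else 0) := by
    rw [← Equiv.sum_comp (bxorPerm w)
      (fun u => W g u * (if (∀ z, twist (bxor u w) (φ z) = 1) then (2 : ℝ) ^ m else 0)), mul_sum]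
    refine sum_congr rfl fun v _ => ?_
    have hv : bxor (bxor w v) w = v := by rw [bxor_comm, bxor_bxor_cancel_left]
    simp only [bxorPerm_apply, hv]
    rw [W_eq_of_fsum_sq f g hf hg hS]
    split_ifs <;> ring
  have key : (2 : ℝ) ^ m * g zeroVec = ((2 : ℝ) ^ n)⁻¹ * ((2 : ℝ) ^ m * (fsum f g / 2 ^ n) *
      ∑ v, (if (∀ z, twist v (φ z) = 1) then f (bxor w v) else 0)) := by
    rw [← h1, h2, h3]
  calc fsum f g * ∑ v, (if (∀ z, twist v (φ z) = 1) then f (bxor w v) else 0)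
      = (2 : ℝ) ^ n * 2 ^ n * (((2 : ℝ) ^ n)⁻¹ * ((2 : ℝ) ^ m * (fsum f g / 2 ^ n) *
          ∑ v, (if (∀ z, twist v (φ z) = 1) then f (bxor w v) else 0))) / 2 ^ m := by
        field_simp
    _ = (2 : ℝ) ^ n * 2 ^ n * ((2 : ℝ) ^ m * g zeroVec) / 2 ^ m := by rw [← key]
    _ = (2 : ℝ) ^ n * 2 ^ n * g zeroVec := by field_simp

/-- The same over the tree's `forrelation` for Boolean data: on the exact slice, given a flat of
affinity of `g` (through `w`), `Φ · ∑_{v ⊥ φ} (-1)^{f(w ⊕ v)} = √(2ⁿ) · (-1)^{g(0)}`. With a normality flat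
(`m = n/2`, `φ` injective) the sum has `2^{n/2}` equal terms and `Φ = (-1)^{g(0)} (-1)^{f(w)}`. [folklore] -/
theorem forrelation_mul_cosetBias_eq (φ : (Fin m → Bool) → (Fin n → Bool))
    (hφ : ∀ z z', φ (bxor z z') = bxor (φ z) (φ z')) (f g : (Fin n → Bool) → Bool)
    (hΦ : forrelation f g ^ 2 = 1) (w : Fin n → Bool)
    (haff : ∀ z, signOf (g (φ z)) * twist w (φ z) = signOf (g zeroVec)) :
    forrelation f g * ∑ v, (if (∀ z, twist v (φ z) = 1) then signOf (f (bxor w v)) else 0) =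
      Real.sqrt ((2 : ℝ) ^ n) * signOf (g zeroVec) := by
  have hf : ∀ x, (fun x => signOf (f x)) x ^ 2 = 1 := fun x => signOf_sq (f x)
  have hg : ∀ y, (fun y => signOf (g y)) y ^ 2 = 1 := fun y => signOf_sq (g y)
  have key := two_pow_mul_forrelation_sq f g
  rw [hΦ, mul_one, sum_dwt_mul_dwt] at key
  have hS : fsum (fun x => signOf (f x)) (fun y => signOf (g y)) ^ 2 = (8 : ℝ) ^ n := by
    rw [← key, pow_mul]; norm_num
  have hb := fsum_mul_cosetBias_eq φ hφ _ _ hf hg hS w haff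
  have hrel : forrelation f g = (Real.sqrt ((2 : ℝ) ^ (3 * n)))⁻¹ *
      fsum (fun x => signOf (f x)) (fun y => signOf (g y)) := by
    rw [← phi_signOf, phi_eq_fsum]
  have hsq : Real.sqrt ((2 : ℝ) ^ n) ≠ 0 := (Real.sqrt_pos.2 (by positivity)).ne'
  have h2n : (2 : ℝ) ^ n ≠ 0 := pow_ne_zero _ two_ne_zero
  have hss : Real.sqrt ((2 : ℝ) ^ n) * Real.sqrt ((2 : ℝ) ^ n) = 2 ^ n :=
    Real.mul_self_sqrt (by positivity)
  rw [hrel, sqrt_eight_pow, mul_assoc, hb, inv_mul_eq_iff_eq_mul₀ (mul_ne_zero hsq h2n)]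
  rw [show Real.sqrt ((2 : ℝ) ^ n) * 2 ^ n * (Real.sqrt ((2 : ℝ) ^ n) * signOf (g zeroVec)) =
      Real.sqrt ((2 : ℝ) ^ n) * Real.sqrt ((2 : ℝ) ^ n) * 2 ^ n * signOf (g zeroVec) by ring, hss]

end Flat

end Summit.QuantumAdvantage.QuantumAdvantage.Theorems.CubicForrelationInPrBPP.Negative

end
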